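import Summits.AtomisticToContinuum.HydrodynamicLimit.Theses.SuperextensiveClosureCost

/-!
# Birth skeleton — crux `MaxSpeedBoundPreShock` (stmt-AtomisticToContinuum-9511)

Route `route-AtomisticToContinuum-SuperextensiveClosureCost` (crux rank 3; shared with
CornersLogPrice rank 5 and SinaiSteeringDichotomy support). The crux: along the deterministic
hard-sphere flow from local Gibbs data, PRE-SHOCK (classical hard-sphere Euler solution on
`[0,T)`, LLN of the fields at `t = 0`), for every `t < T`,
`localGibbsLaw {∃ r ∈ [0,t], ∃ i, (N+1)^{1/24} < ‖v_i(Φ_r z)‖} → 0`.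

LINE (first-moment / "speed records are set at collisions"; the route header's foreseen split
"Povzner-type pathwise cascade bound → union over ≍ N^{4/3} collisions"):

* `stub_initialSpeedTail` (STATIC, size M): under the local Gibbs law the velocity of each sphere
  is, conditionally on the positions, Gaussian `N(u₀(q_i), θ₀(q_i)·1)` with `θ₀ ≤ θ_max`,
  `‖u₀‖ ≤ U` (continuous profiles on the compact torus); extreme values of `N + 1` such speeds are
  `≍ √(2 θ_max log N) ≪ (N+1)^{1/24}`, so `LG{∃ i, (N+1)^{1/24} < ‖v_i(0)‖} → 0` (union bound over
  the `N + 1` exchangeable marginals of `canonicalDensity`; the `𝒵 = 0` junk branch gives the zero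
  measure, for which the claim is trivial). No smallness of `σ` is needed.
* `stub_recordAtCollision` (PATHWISE, deterministic, size M): on a good orbit velocities are
  piecewise constant — free flight between the locally finitely many collision times
  (`IsHardSphereTrajectory.free`, `freeFlight` keeps `(z i).2`) and `Φ.flow 0 z = z` — so if no
  sphere is faster than `c` at time `0` and some sphere is faster than `c` at some `r ∈ [0,t]`, then
  at the LAST collision time `r' ∈ (0, r]` before `r` some sphere is already faster than `c`:
  an ENERGISING COLLISION (a collision time in `(0,t]` right after which a sphere exceeds `c`).
* `stub_energisingCollisionsRare` (DYNAMIC, the load-bearing a-priori estimate, open): pre-shock,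
  the NUMBER of energising collisions at level `(N+1)^{1/24}` in `(0,t]` has a measurable majorant
  whose `LG`-expectation tends to `0` (first-moment method: expected count = ∫ of the one-collision
  intensity with a fast OUTGOING sphere, i.e. incoming pair energy `> (N+1)^{1/12}`; at local
  equilibrium this is `≍ σ² t (N+1)^{4/3} · e^{-(N+1)^{1/12}/(4 θ_max)} → 0`). This is where a
  Povzner-type cascade bound / a one-sided Stosszahlansatz ceiling for marks with ONE rare
  participant (cf. SpeedCapSurgery's `ContactIntensityDominationOneRare`, stmt-16939, and its glue
  `TailsToMaxSpeedR`) bites; the measurable majorant absorbs the measurability of the collision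
  count (`EmpiricalCollisionMeasureMeasurable`-type bookkeeping) into the stub.

ASSEMBLY (proved below, sorry-free). Device of `Cruxes/LagHandOff/Lines/crosscut-dictionary.lean` /
`CardyFormulaZ2/Cruxes/LoopsToCrossings/Lines/br-sandwich-diagonal.lean`: each stub statement is a `def X : Prop`,
restated verbatim by its registered `theorem stub_x : … := by sorry` (the only `sorry`s of the file) and aliased as
`__Registered.stub_x` (implementation-detail namespace, keyed by the stub's short name, so the native skeleton
audit admits it as a hypothesis BY NAME); `MaxSpeedBoundPreShock_of : __Registered.stub_initialSpeedTail →
__Registered.stub_recordAtCollision → __Registered.stub_energisingCollisionsRare → <crux>` is the kernel-checked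
composition (axioms propext / Classical.choice / Quot.sound) and `MaxSpeedBoundPreShock_proof : <crux>` applies it
to the three `stub_…` literally (which checks that defs, aliases and stubs agree). The argument (`speedEvent_measure_le`): for each `N`,
`E_N ⊆ A_N ∪ goodᶜ ∪ {1 ≤ g_N}` (record lemma + local finiteness of collision times ⇒ the finite
set of energising collision times is nonempty ⇒ `1 ≤ ncard ≤ g_N`), `LG(goodᶜ) = 0`
(`localGibbsLaw = liouville.withDensity _ ≪ liouville`, `measure_compl_good`), Markov
`LG{1 ≤ g_N} ≤ ∫⁻ g_N dLG`, subadditivity and a squeeze in `ℝ≥0∞`.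

Disproof used: none relevant (no `Disproof.lean` / Negative lemma exists for this crux at
registration; `ledger negatives`: the refuted two-copies ceiling ContactIntensityDomination
(stmt-9218, hot-spot witness) is NOT assumed — `stub_energisingCollisionsRare` is an `N → ∞`
statement about the true flow, not a mark-uniform finite-`N` intensity ceiling).
-/

namespace Summit.AtomisticToContinuum.HydrodynamicLimit.Cruxes.MaxSpeedBoundPreShock.Birth

open MeasureTheory Filter Set Topology
open scoped ENNReal

/-! ### The three statements of the line (precise `Prop`s) -/

/-- STATEMENT 1 (static extreme-value tail of the local Gibbs law at level `(N+1)^{1/24}`; see `stub_initialSpeedTail`). -/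
def InitialSpeedTail : Prop :=
  ∀ (a₀ θ₀ : Literature.MathematicalPhysics.KineticTheory.T3 → ℝ)
    (u₀ : Literature.MathematicalPhysics.KineticTheory.T3 → Literature.MathematicalPhysics.KineticTheory.V3),
    Continuous a₀ → Continuous θ₀ → Continuous u₀ → (∀ x, 0 < a₀ x) → (∀ x, 0 < θ₀ x) →
    ∀ σ : ℝ, 0 < σ →
    ∀ Φ : (N : ℕ) → Literature.Analysis.FluidPDE.HardSphereFlow
        (Literature.Analysis.FluidPDE.Torus.geometry (Fin 3))
        (Literature.MathematicalPhysics.KineticTheory.hsDiameter σ N) (N + 1),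
    Filter.Tendsto (fun N : ℕ => Literature.MathematicalPhysics.KineticTheory.localGibbsLaw σ a₀ u₀ θ₀ N (Φ N)
      {z | ∃ i, ((N + 1 : ℕ) : ℝ) ^ (1 / 24 : ℝ) < ‖(z i).2‖}) Filter.atTop (nhds 0)

/-- STATEMENT 2 (pathwise record lemma: speed records on a good orbit are set at collision times; see `stub_recordAtCollision`). -/
def RecordAtCollision : Prop :=
  ∀ (σ : ℝ) (N : ℕ)
    (Φ : Literature.Analysis.FluidPDE.HardSphereFlow
        (Literature.Analysis.FluidPDE.Torus.geometry (Fin 3))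
        (Literature.MathematicalPhysics.KineticTheory.hsDiameter σ N) (N + 1))
    (z : Literature.Analysis.FluidPDE.Config (N + 1) (Fin 3) Literature.MathematicalPhysics.KineticTheory.T3),
    z ∈ Φ.good → ∀ (c t : ℝ), (∀ i, ‖(z i).2‖ ≤ c) →
    (∃ r ∈ Set.Icc 0 t, ∃ i, c < ‖(Φ.flow r z i).2‖) →
    ∃ r ∈ Set.Ioc 0 t,
      r ∈ Literature.Analysis.FluidPDE.collisionTimes
            (Literature.Analysis.FluidPDE.Torus.geometry (Fin 3))
            (Literature.MathematicalPhysics.KineticTheory.hsDiameter σ N) (fun s => Φ.flow s z) ∧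
      ∃ i, c < ‖(Φ.flow r z i).2‖

/-- STATEMENT 3 (pre-shock first-moment bound on energising collisions, the load-bearing a-priori estimate; see `stub_energisingCollisionsRare`). -/
def EnergisingCollisionsRare : Prop :=
  ∀ (a₀ θ₀ : Literature.MathematicalPhysics.KineticTheory.T3 → ℝ)
    (u₀ : Literature.MathematicalPhysics.KineticTheory.T3 → Literature.MathematicalPhysics.KineticTheory.V3),
    Continuous a₀ → Continuous θ₀ → Continuous u₀ → (∀ x, 0 < a₀ x) → (∀ x, 0 < θ₀ x) →
    ∃ σ₀ : ℝ, 0 < σ₀ ∧ ∀ σ : ℝ, 0 < σ → σ < σ₀ →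
    ∀ (T : ℝ) (ρ θ : ℝ → Literature.MathematicalPhysics.KineticTheory.T3 → ℝ)
      (u : ℝ → Literature.MathematicalPhysics.KineticTheory.T3 → Literature.MathematicalPhysics.KineticTheory.V3),
    Literature.MathematicalPhysics.KineticTheory.IsHardSphereEulerSolution σ T ρ u θ →
    ∀ Φ : (N : ℕ) → Literature.Analysis.FluidPDE.HardSphereFlow
        (Literature.Analysis.FluidPDE.Torus.geometry (Fin 3))
        (Literature.MathematicalPhysics.KineticTheory.hsDiameter σ N) (N + 1),
    Literature.MathematicalPhysics.KineticTheory.TendstoHydroFieldsAt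
        (fun N => Literature.MathematicalPhysics.KineticTheory.localGibbsLaw σ a₀ u₀ θ₀ N (Φ N)) Φ ρ u θ 0 →
    ∀ t ∈ Set.Ico 0 T,
    ∃ g : (N : ℕ) → Literature.Analysis.FluidPDE.Config (N + 1) (Fin 3) Literature.MathematicalPhysics.KineticTheory.T3 → ℝ≥0∞,
      (∀ N, Measurable (g N)) ∧
      (∀ N, ∀ z ∈ (Φ N).good,
        (((Literature.Analysis.FluidPDE.collisionTimes
              (Literature.Analysis.FluidPDE.Torus.geometry (Fin 3))
              (Literature.MathematicalPhysics.KineticTheory.hsDiameter σ N) (fun s => (Φ N).flow s z)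
            ∩ Set.Ioc 0 t ∩ {r | ∃ i, ((N + 1 : ℕ) : ℝ) ^ (1 / 24 : ℝ) < ‖((Φ N).flow r z i).2‖}).ncard : ℕ) : ℝ≥0∞)
          ≤ g N z) ∧
      Filter.Tendsto (fun N : ℕ => ∫⁻ z, g N z ∂(Literature.MathematicalPhysics.KineticTheory.localGibbsLaw σ a₀ u₀ θ₀ N (Φ N)))
        Filter.atTop (nhds 0)

/-! ### The registered stubs `stub_…` (the only `sorry`s of the file; statements restated verbatim) -/

/-- stub 1 (STATIC extreme-value tail of the local Gibbs law at the polynomial level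
`(N+1)^{1/24}`): for continuous positive profiles, every `σ > 0` and every flow family,
`localGibbsLaw σ a₀ u₀ θ₀ N (Φ N) {z | ∃ i, (N+1)^{1/24} < ‖(z i).2‖} → 0` as `N → ∞`.
Conditionally on positions the velocities are independent Gaussians of variance `θ₀(q_i) ≤ θ_max`
and mean `u₀(q_i)`, `‖u₀‖ ≤ U`; union bound over `N + 1` marginals:
`≤ (N+1)·C·exp(-((N+1)^{1/24} - U)²/(2θ_max)) → 0`. [size M; provable now from
`canonicalDensity` / `localMaxwellian`; Spohn1991 Part I Ch. 3] -/
theorem stub_initialSpeedTail :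
    ∀ (a₀ θ₀ : Literature.MathematicalPhysics.KineticTheory.T3 → ℝ)
      (u₀ : Literature.MathematicalPhysics.KineticTheory.T3 → Literature.MathematicalPhysics.KineticTheory.V3),
      Continuous a₀ → Continuous θ₀ → Continuous u₀ → (∀ x, 0 < a₀ x) → (∀ x, 0 < θ₀ x) →
      ∀ σ : ℝ, 0 < σ →
      ∀ Φ : (N : ℕ) → Literature.Analysis.FluidPDE.HardSphereFlow
          (Literature.Analysis.FluidPDE.Torus.geometry (Fin 3))
          (Literature.MathematicalPhysics.KineticTheory.hsDiameter σ N) (N + 1),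
      Filter.Tendsto (fun N : ℕ => Literature.MathematicalPhysics.KineticTheory.localGibbsLaw σ a₀ u₀ θ₀ N (Φ N)
        {z | ∃ i, ((N + 1 : ℕ) : ℝ) ^ (1 / 24 : ℝ) < ‖(z i).2‖}) Filter.atTop (nhds 0) := by
  sorry

/-- stub 2 (PATHWISE record lemma, deterministic): on a good orbit of a hard-sphere flow, if every
sphere has speed `≤ c` at time `0` and some sphere has speed `> c` at some time `r ∈ [0, t]`, then
there is a collision time `r' ∈ (0, t]` of the orbit at which (i.e. right after which — orbits are
right-continuous) some sphere has speed `> c`. Proof: `Φ.flow 0 z = z`; collision times in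
`[0, r]` are finite (`IsHardSphereTrajectory.locFinite`); with no collision in `(0, r]` the orbit
is free flight from `z` (velocities unchanged, contradiction), else take the last collision time
`r' ≤ r` and free flight on `(r', r]`. [size M; provable now from `HardSphereFlow.isTrajectory`,
`IsHardSphereTrajectory.free`, `freeFlight_apply`; GST2013 §4.1, Alexander1975] -/
theorem stub_recordAtCollision :
    ∀ (σ : ℝ) (N : ℕ)
      (Φ : Literature.Analysis.FluidPDE.HardSphereFlow
          (Literature.Analysis.FluidPDE.Torus.geometry (Fin 3))
          (Literature.MathematicalPhysics.KineticTheory.hsDiameter σ N) (N + 1))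
      (z : Literature.Analysis.FluidPDE.Config (N + 1) (Fin 3) Literature.MathematicalPhysics.KineticTheory.T3),
      z ∈ Φ.good → ∀ (c t : ℝ), (∀ i, ‖(z i).2‖ ≤ c) →
      (∃ r ∈ Set.Icc 0 t, ∃ i, c < ‖(Φ.flow r z i).2‖) →
      ∃ r ∈ Set.Ioc 0 t,
        r ∈ Literature.Analysis.FluidPDE.collisionTimes
              (Literature.Analysis.FluidPDE.Torus.geometry (Fin 3))
              (Literature.MathematicalPhysics.KineticTheory.hsDiameter σ N) (fun s => Φ.flow s z) ∧
        ∃ i, c < ‖(Φ.flow r z i).2‖ := by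
  sorry

/-- stub 3 (DYNAMIC a-priori estimate, load-bearing, open: "energising collisions are rare in the
mean, pre-shock"): under the crux's prefix (continuous positive profiles, `σ < σ₀`, classical
hard-sphere Euler solution on `[0,T)`, LLN of the fields at `t = 0`), for every `t < T` there is a
MEASURABLE majorant `g N` of the number of energising collisions at level `(N+1)^{1/24}` — collision
times `r ∈ (0, t]` of the orbit of `z` right after which some sphere is faster than `(N+1)^{1/24}` —
on good orbits, with `∫⁻ g N d(localGibbsLaw) → 0`. First-moment method: the expected count is the
time integral of the one-collision intensity with outgoing speed `> (N+1)^{1/24}` (incoming pair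
energy `> (N+1)^{1/12}`): `≍ σ² t (N+1)^{4/3} e^{-(N+1)^{1/12}/(4θ_max)} → 0` at local equilibrium;
rigorously a Povzner-type cascade bound / one-rare-participant Stosszahlansatz ceiling along the
NON-equilibrium flow (cf. SpeedCapSurgery: ContactIntensityDominationOneRare stmt-16939,
TailsToMaxSpeedR). Why it might fail: want of technique — collision statistics along the
deterministic non-equilibrium flow are controlled neither by the `O(N)` relative entropy nor by
the `e^{O(N)}` `L²` transfer budget (a channelled sphere costs only `N^{1/12}` at equilibrium).
[size XL / open-problem; NachtergaeleYau2003 §2.3, OllaVaradhanYau1993 §1, GST2013 §4,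
PulvirentiSimonella2016, Spohn1991] -/
theorem stub_energisingCollisionsRare :
    ∀ (a₀ θ₀ : Literature.MathematicalPhysics.KineticTheory.T3 → ℝ)
      (u₀ : Literature.MathematicalPhysics.KineticTheory.T3 → Literature.MathematicalPhysics.KineticTheory.V3),
      Continuous a₀ → Continuous θ₀ → Continuous u₀ → (∀ x, 0 < a₀ x) → (∀ x, 0 < θ₀ x) →
      ∃ σ₀ : ℝ, 0 < σ₀ ∧ ∀ σ : ℝ, 0 < σ → σ < σ₀ →
      ∀ (T : ℝ) (ρ θ : ℝ → Literature.MathematicalPhysics.KineticTheory.T3 → ℝ)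
        (u : ℝ → Literature.MathematicalPhysics.KineticTheory.T3 → Literature.MathematicalPhysics.KineticTheory.V3),
      Literature.MathematicalPhysics.KineticTheory.IsHardSphereEulerSolution σ T ρ u θ →
      ∀ Φ : (N : ℕ) → Literature.Analysis.FluidPDE.HardSphereFlow
          (Literature.Analysis.FluidPDE.Torus.geometry (Fin 3))
          (Literature.MathematicalPhysics.KineticTheory.hsDiameter σ N) (N + 1),
      Literature.MathematicalPhysics.KineticTheory.TendstoHydroFieldsAt
          (fun N => Literature.MathematicalPhysics.KineticTheory.localGibbsLaw σ a₀ u₀ θ₀ N (Φ N)) Φ ρ u θ 0 →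
      ∀ t ∈ Set.Ico 0 T,
      ∃ g : (N : ℕ) → Literature.Analysis.FluidPDE.Config (N + 1) (Fin 3) Literature.MathematicalPhysics.KineticTheory.T3 → ℝ≥0∞,
        (∀ N, Measurable (g N)) ∧
        (∀ N, ∀ z ∈ (Φ N).good,
          (((Literature.Analysis.FluidPDE.collisionTimes
                (Literature.Analysis.FluidPDE.Torus.geometry (Fin 3))
                (Literature.MathematicalPhysics.KineticTheory.hsDiameter σ N) (fun s => (Φ N).flow s z)
              ∩ Set.Ioc 0 t ∩ {r | ∃ i, ((N + 1 : ℕ) : ℝ) ^ (1 / 24 : ℝ) < ‖((Φ N).flow r z i).2‖}).ncard : ℕ) : ℝ≥0∞)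
            ≤ g N z) ∧
        Filter.Tendsto (fun N : ℕ => ∫⁻ z, g N z ∂(Literature.MathematicalPhysics.KineticTheory.localGibbsLaw σ a₀ u₀ θ₀ N (Φ N)))
          Filter.atTop (nhds 0) := by
  sorry

/-! ### Name-keyed aliases of the three statements (the hypotheses of the composition)

`__Registered.stub_x` is statement `X` under the registered stub's short name, so that the native skeleton audit
(`#h21_check_skeleton`: hypotheses admissible iff registered obligations / declared stubs BY NAME) accepts
`MaxSpeedBoundPreShock_of : __Registered.stub_… → … → MaxSpeedBoundPreShock` (device of
`Cruxes/LagHandOff/Lines/crosscut-dictionary.lean`; the namespace is an implementation detail, so the audit's stub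
report resolves each `stub_…` to the sorried theorem, not to its alias; the audit's `@[stub]` attribute is
gate-reserved and is not written by a planner). -/
namespace __Registered

/-- Alias of `InitialSpeedTail` keyed by the registered stub name. -/
abbrev stub_initialSpeedTail : Prop := InitialSpeedTail
/-- Alias of `RecordAtCollision` keyed by the registered stub name. -/
abbrev stub_recordAtCollision : Prop := RecordAtCollision
/-- Alias of `EnergisingCollisionsRare` keyed by the registered stub name. -/
abbrev stub_energisingCollisionsRare : Prop := EnergisingCollisionsRare

end __Registered

/-! ### The composition (kernel-checked, no `sorry`) -/

/-- PER-`N` UNION BOUND (the measure-theoretic core of the assembly, shared by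
`MaxSpeedBoundPreShock_proof` and `MaxSpeedBoundPreShock_of`): for a threshold `c`, a measurable
majorant `g` of the number of level-`c` energising collision times in `(0,t]` on good orbits, and
the record property at level `c`, the law of the event "some sphere faster than `c` at some
`r ∈ [0,t]`" is at most the law of "some sphere faster than `c` at time `0`" plus `∫⁻ g`:
`E ⊆ A ∪ goodᶜ ∪ {1 ≤ g}` (record lemma + local finiteness of collision times on good orbits ⇒ the
finite set of energising collision times is nonempty ⇒ `1 ≤ ncard ≤ g`), `LG(goodᶜ) = 0`
(`localGibbsLaw = liouville.withDensity _ ≪ liouville`, `measure_compl_good`), Markov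
`LG{1 ≤ g} ≤ ∫⁻ g dLG`, subadditivity. -/
theorem speedEvent_measure_le (σ : ℝ) (a₀ θ₀ : Literature.MathematicalPhysics.KineticTheory.T3 → ℝ)
    (u₀ : Literature.MathematicalPhysics.KineticTheory.T3 → Literature.MathematicalPhysics.KineticTheory.V3)
    (N : ℕ)
    (Φ : Literature.Analysis.FluidPDE.HardSphereFlow
        (Literature.Analysis.FluidPDE.Torus.geometry (Fin 3))
        (Literature.MathematicalPhysics.KineticTheory.hsDiameter σ N) (N + 1))
    (c t : ℝ)
    (g : Literature.Analysis.FluidPDE.Config (N + 1) (Fin 3) Literature.MathematicalPhysics.KineticTheory.T3 → ℝ≥0∞)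
    (hgm : Measurable g)
    (hgc : ∀ z ∈ Φ.good,
      (((Literature.Analysis.FluidPDE.collisionTimes
            (Literature.Analysis.FluidPDE.Torus.geometry (Fin 3))
            (Literature.MathematicalPhysics.KineticTheory.hsDiameter σ N) (fun s => Φ.flow s z)
          ∩ Set.Ioc 0 t ∩ {r | ∃ i, c < ‖(Φ.flow r z i).2‖}).ncard : ℕ) : ℝ≥0∞) ≤ g z)
    (hRecord : ∀ z ∈ Φ.good, (∀ i, ‖(z i).2‖ ≤ c) →
      (∃ r ∈ Set.Icc 0 t, ∃ i, c < ‖(Φ.flow r z i).2‖) →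
      ∃ r ∈ Set.Ioc 0 t,
        r ∈ Literature.Analysis.FluidPDE.collisionTimes
              (Literature.Analysis.FluidPDE.Torus.geometry (Fin 3))
              (Literature.MathematicalPhysics.KineticTheory.hsDiameter σ N) (fun s => Φ.flow s z) ∧
        ∃ i, c < ‖(Φ.flow r z i).2‖) :
    Literature.MathematicalPhysics.KineticTheory.localGibbsLaw σ a₀ u₀ θ₀ N Φ
        {z | ∃ r ∈ Set.Icc 0 t, ∃ i, c < ‖(Φ.flow r z i).2‖}
      ≤ Literature.MathematicalPhysics.KineticTheory.localGibbsLaw σ a₀ u₀ θ₀ N Φ {z | ∃ i, c < ‖(z i).2‖}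
        + ∫⁻ z, g z ∂(Literature.MathematicalPhysics.KineticTheory.localGibbsLaw σ a₀ u₀ θ₀ N Φ) := by
  set μ := Literature.MathematicalPhysics.KineticTheory.localGibbsLaw σ a₀ u₀ θ₀ N Φ with hμ
  -- step 1: the set inclusion
  have hsub : {z | ∃ r ∈ Set.Icc 0 t, ∃ i, c < ‖(Φ.flow r z i).2‖}
      ⊆ ({z | ∃ i, c < ‖(z i).2‖} ∪ (Φ.good)ᶜ) ∪ {z | (1 : ℝ≥0∞) ≤ g z} := by
    intro z hz
    by_cases hA : z ∈ {z | ∃ i, c < ‖(z i).2‖}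
    · exact Or.inl (Or.inl hA)
    by_cases hgood : z ∈ Φ.good
    · right
      have hA' : ∀ i, ‖(z i).2‖ ≤ c := fun i => not_lt.mp fun h => hA ⟨i, h⟩
      obtain ⟨r, hr, hrcoll, i, hi⟩ := hRecord z hgood hA' hz
      have hfin : (Literature.Analysis.FluidPDE.collisionTimes
              (Literature.Analysis.FluidPDE.Torus.geometry (Fin 3))
              (Literature.MathematicalPhysics.KineticTheory.hsDiameter σ N) (fun s => Φ.flow s z)
            ∩ Set.Ioc 0 t ∩ {r | ∃ i, c < ‖(Φ.flow r z i).2‖}).Finite := by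
        refine ((Φ.isTrajectory z hgood).locFinite 0 t).subset ?_
        intro r' hr'
        exact ⟨hr'.1.1, Set.Ioc_subset_Icc_self hr'.1.2⟩
      have hne : (Literature.Analysis.FluidPDE.collisionTimes
              (Literature.Analysis.FluidPDE.Torus.geometry (Fin 3))
              (Literature.MathematicalPhysics.KineticTheory.hsDiameter σ N) (fun s => Φ.flow s z)
            ∩ Set.Ioc 0 t ∩ {r | ∃ i, c < ‖(Φ.flow r z i).2‖}).Nonempty :=
        ⟨r, ⟨hrcoll, hr⟩, i, hi⟩
      have hpos := (Set.ncard_pos hfin).mpr hne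
      have h1 : (1 : ℝ≥0∞) ≤ ((Literature.Analysis.FluidPDE.collisionTimes
              (Literature.Analysis.FluidPDE.Torus.geometry (Fin 3))
              (Literature.MathematicalPhysics.KineticTheory.hsDiameter σ N) (fun s => Φ.flow s z)
            ∩ Set.Ioc 0 t ∩ {r | ∃ i, c < ‖(Φ.flow r z i).2‖}).ncard : ℝ≥0∞) := by
        exact_mod_cast hpos
      exact le_trans h1 (hgc z hgood)
    · exact Or.inl (Or.inr hgood)
  -- step 2: bad initial data are Liouville-null, hence null for the local Gibbs law
  have hnull : μ (Φ.good)ᶜ = 0 := by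
    rw [hμ]
    exact MeasureTheory.withDensity_absolutelyContinuous _ _ Φ.measure_compl_good
  -- step 3: Markov at level 1
  have hmarkov : μ {z | (1 : ℝ≥0∞) ≤ g z} ≤ ∫⁻ z, g z ∂μ := by
    have := MeasureTheory.mul_meas_ge_le_lintegral₀ hgm.aemeasurable (1 : ℝ≥0∞) (μ := μ)
    simpa using this
  calc μ {z | ∃ r ∈ Set.Icc 0 t, ∃ i, c < ‖(Φ.flow r z i).2‖}
      ≤ μ (({z | ∃ i, c < ‖(z i).2‖} ∪ (Φ.good)ᶜ) ∪ {z | (1 : ℝ≥0∞) ≤ g z}) :=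
        MeasureTheory.measure_mono hsub
    _ ≤ μ ({z | ∃ i, c < ‖(z i).2‖} ∪ (Φ.good)ᶜ) + μ {z | (1 : ℝ≥0∞) ≤ g z} :=
        MeasureTheory.measure_union_le _ _
    _ ≤ (μ {z | ∃ i, c < ‖(z i).2‖} + μ (Φ.good)ᶜ) + μ {z | (1 : ℝ≥0∞) ≤ g z} := by
        gcongr
        exact MeasureTheory.measure_union_le _ _
    _ ≤ μ {z | ∃ i, c < ‖(z i).2‖} + ∫⁻ z, g z ∂μ := by
        rw [hnull, add_zero]
        gcongr

/-- **`MaxSpeedBoundPreShock` from the three stubs** (BC3 form `stub₁ → stub₂ → stub₃ → <crux BY NAME>`;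
sorry-free, axioms `propext` / `Classical.choice` / `Quot.sound`): take `σ₀` from STATEMENT 3; for admissible
`σ, T, (ρ,u,θ), Φ, t` get the measurable majorants `g N`; `speedEvent_measure_le` at level `c = (N+1)^{1/24}` with
STATEMENT 2 bounds the law of the crux event by `LG{fast at time 0} + ∫⁻ g N`, whose two terms tend to `0` by
STATEMENTS 1 and 3; squeeze in `ℝ≥0∞`. -/
theorem MaxSpeedBoundPreShock_of (hTail : __Registered.stub_initialSpeedTail)
    (hRecord : __Registered.stub_recordAtCollision) (hRare : __Registered.stub_energisingCollisionsRare) :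
    Summit.AtomisticToContinuum.HydrodynamicLimit.Theses.SuperextensiveClosureCost.MaxSpeedBoundPreShock := by
  intro a₀ θ₀ u₀ ha hθ hu hap hθp
  obtain ⟨σ₀, hσ₀, H⟩ := hRare a₀ θ₀ u₀ ha hθ hu hap hθp
  refine ⟨σ₀, hσ₀, fun σ hσ hσlt T ρ θ u hsol Φ h0 t ht => ?_⟩
  obtain ⟨g, hgm, hgc, hgt⟩ := H σ hσ hσlt T ρ θ u hsol Φ h0 t ht
  have hT := hTail a₀ θ₀ u₀ ha hθ hu hap hθp σ hσ Φ
  have hbound := fun N : ℕ =>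
    speedEvent_measure_le σ a₀ θ₀ u₀ N (Φ N) (((N + 1 : ℕ) : ℝ) ^ (1 / 24 : ℝ)) t (g N) (hgm N) (hgc N)
      (fun z hz => hRecord σ N (Φ N) z hz (((N + 1 : ℕ) : ℝ) ^ (1 / 24 : ℝ)) t)
  have hsum : Filter.Tendsto (fun N : ℕ =>
      Literature.MathematicalPhysics.KineticTheory.localGibbsLaw σ a₀ u₀ θ₀ N (Φ N)
          {z | ∃ i, ((N + 1 : ℕ) : ℝ) ^ (1 / 24 : ℝ) < ‖(z i).2‖}
        + ∫⁻ z, g N z ∂(Literature.MathematicalPhysics.KineticTheory.localGibbsLaw σ a₀ u₀ θ₀ N (Φ N)))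
      Filter.atTop (nhds 0) := by
    simpa using hT.add hgt
  exact tendsto_of_tendsto_of_tendsto_of_le_of_le tendsto_const_nhds hsum (fun N => zero_le) hbound

/-- REGISTERED SKELETON CLOSING THEOREM: the crux BY NAME from the three `stub_…` literally (its only `sorryAx`
dependence is through them; it is a closed proof of the crux exactly when the three stubs are proved, and it
type-checks only because defs, aliases and stub statements agree). -/
theorem MaxSpeedBoundPreShock_proof :
    Summit.AtomisticToContinuum.HydrodynamicLimit.Theses.SuperextensiveClosureCost.MaxSpeedBoundPreShock :=
  MaxSpeedBoundPreShock_of stub_initialSpeedTail stub_recordAtCollision stub_energisingCollisionsRare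

end Summit.AtomisticToContinuum.HydrodynamicLimit.Cruxes.MaxSpeedBoundPreShock.Birth
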